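import Summits.CriticalPhenomena.SAWScalingLimit.Theorems.SAWDevelopingMapHexTightPinchDefs
import Literature.Probability.RandomPlanarGeometry.CurvePinch
import Mathlib.Analysis.SpecialFunctions.Pow.Real
import HarnessLib

/-!
# Stub `stub_rootedTightOfPinch` of the line `reversal-virgin-disc` (crux `HexTight`, stmt-CriticalPhenomena-5423)

Landing target `Summits/CriticalPhenomena/SAWScalingLimit/Theorems/SAWDevelopingMapHexTightRootedTightOfPinch.lean`;
objects (`IsHArc`, `arcCurve`, `arcMass`, `travMass`, `Straddles`, `IsVirgin`) from
`SAWDevelopingMapHexTightReversalDefs.lean`; the two named hypotheses `TravLocalization` (traversal-localization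
surgery) and `ArcPinchBound` (two-strand pinch power bound) of the lead's skeleton r5 from
`SAWDevelopingMapHexTightPinchDefs.lean`; plane geometry from `Literature/…/CurvePinch.lean`
(`Curve.exists_pinch_of_hasTraversals`, `exists_dist_circleNet_le`) and `CurveTortuosity.lean`
(`Curve.HasTraversals.mono`, `.mono'`).

WHAT. The registered stub `stub_rootedTightOfPinch : TravLocalization → ArcPinchBound → RootedTraversalTight`:
ROOTED rate-free traversal tightness — arcs of the punctured domain `Λ ∖ {p}` from a rim door `w` to the mid-edge
`{q, p}` of a lattice edge into a deep root `p`, `dist(c(p), z₀) ≤ N/A ≤ N/4` — follows from the pinch bound.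

HOW (Aizenman–Burchard pinch reduction, exactly as for the chordal class). `{q, p} = {p, q}` with `p ∉ Λ ∖ {p}`,
`p ∼ q`, so the rooted class is a door-to-door class of `Λ₀ := Λ ∖ {p}` in the format of `TravLocalization`
(`u' := p`, `c' := q`). An arc with `k₀` separate traversals of `D(z₀; N/A, N/2) ⊇ D(z₀; 3N/8, N/2)` makes, by
the pigeonhole on the middle circle (`Curve.exists_pinch_of_hasTraversals`), four separate traversals of
`D(y; 4πm/k₀, N/16)`, `|y - z₀| = m := 7N/16`, hence (`exists_dist_circleNet_le`, `HasTraversals.mono`) of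
`D(yⱼ; ρ, N/16 - d)`, `ρ := 6πm/k₀`, `d := 2πm/k₀`, about one of the `k₀` net points `yⱼ` of that circle (union
bound `rootedTight_travMass_le_sum_net`). About each net point the punctured configuration is virgin at radius
`r₁ := N/16 + 2` (that disc lies in the annulus `3N/8 - 2 < |· - z₀| < N/2 + 2`, inside the virgin `N`-disc and
off the root), both `u` and `p` are `> r₁` away, and `ArcPinchBound` at scale `r₁` with inner radius `ρ + 2`
bounds every virgin sub-configuration, so `TravLocalization` gives the ratio
`θ := K ((ρ+2)/r₁)^{1+s} ≤ K (200/k₀)^{1+s}` per net point (`rootedTight_netPoint`; `π ≤ 4`, `N ≥ k₀`). Summing,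
`k₀ θ ≤ K 200^{1+s} k₀^{-s} ≤ η` once `k₀ ≥ (K 200^{1+s}/η)^{1/s}`; all side conditions hold for `k₀ ≥ 2000`,
`N ≥ max (16 N₀) 256 k₀`.
-/

noncomputable section

open scoped BigOperators Classical
open Literature.Probability.LatticeModels Literature.Probability.RandomPlanarGeometry
  Literature.Probability.RandomPlanarGeometry.SAW

namespace Summit.CriticalPhenomena.SAWScalingLimit.Theorems.HexTight.Reversal

/-! ## Helpers: union bound over the circle net, one net point -/

/-- Union bound: if the event `Q` forces one of the events `Q' j`, `j < k`, then the `P ∧ Q`-mass is at most the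
sum over `j < k` of the `P ∧ Q' j`-masses (nonnegative weights). -/
private theorem rootedTight_sum_ite_le {ι : Type*} [Fintype ι] {P Q : ι → Prop} {Q' : ℕ → ι → Prop}
    [DecidablePred P] [DecidablePred Q] [∀ j, DecidablePred (Q' j)] (f : ι → ℝ) (hf : ∀ i, 0 ≤ f i)
    {k : ℕ} (h : ∀ i, Q i → ∃ j < k, Q' j i) :
    ∑ i, (if P i ∧ Q i then f i else 0) ≤
      ∑ j ∈ Finset.range k, ∑ i, (if P i ∧ Q' j i then f i else 0) := by
  rw [Finset.sum_comm]
  refine Finset.sum_le_sum fun i _ => ?_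
  have h0 : ∀ j ∈ Finset.range k, (0 : ℝ) ≤ if P i ∧ Q' j i then f i else 0 :=
    fun j _ => by split_ifs; exacts [hf i, le_rfl]
  by_cases hi : P i ∧ Q i
  · obtain ⟨j, hj, hQ'⟩ := h i hi.2
    rw [if_pos hi]
    exact le_trans (le_of_eq (if_pos ⟨hi.1, hQ'⟩).symm) (Finset.single_le_sum h0 (Finset.mem_range.2 hj))
  · rw [if_neg hi]
    exact Finset.sum_nonneg h0

/-- **Pinch cover** (plane geometry): `k ≥ 2` separate traversals of `D(z₀; N/A, N/2)`, `A ≥ 4`, force four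
separate traversals of the shell `D(yⱼ; 6πm/k, N/16 - 2πm/k)`, `m = 7N/16`, about one of the `k` net points
`yⱼ = z₀ + m e^{i(-π + 2πj/k)}` of the middle circle of `D(z₀; 3N/8, N/2)`
(`Curve.exists_pinch_of_hasTraversals` + `exists_dist_circleNet_le` + `HasTraversals.mono`). -/
private theorem rootedTight_cover {γ : Curve ℂ} {z₀ : ℂ} {N A : ℝ} {k : ℕ} (hN : 0 < N) (hA : 4 ≤ A)
    (hk : 2 ≤ k) (h : γ.HasTraversals k z₀ (N / A) (N / 2)) :
    ∃ j < k, γ.HasTraversals 4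
      (z₀ + ((7 * N / 16 : ℝ) : ℂ) *
        Complex.exp (((-Real.pi + 2 * Real.pi * j / k : ℝ) : ℂ) * Complex.I))
      (6 * Real.pi * (7 * N / 16) / k) (N / 16 - 2 * Real.pi * (7 * N / 16) / k) := by
  have hNA : N / A ≤ N / 4 := div_le_div_of_nonneg_left hN.le (by norm_num) hA
  have h1 : γ.HasTraversals k z₀ (3 * N / 8) (N / 2) := h.mono' (by linarith) le_rfl
  obtain ⟨y, hy, h4⟩ :=
    Curve.exists_pinch_of_hasTraversals (by positivity) (by linarith) hk h1
  have e1 : (3 * N / 8 + N / 2) / 2 = 7 * N / 16 := by ring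
  have e2 : (N / 2 - 3 * N / 8) / 2 = N / 16 := by ring
  rw [e1] at hy h4
  rw [e2] at h4
  obtain ⟨j, hj, hd⟩ := exists_dist_circleNet_le (by positivity) hy (by omega : 1 ≤ k)
  refine ⟨j, hj, h4.mono ?_ ?_⟩
  · have : 4 * Real.pi * (7 * N / 16) / k + 2 * Real.pi * (7 * N / 16) / k =
        6 * Real.pi * (7 * N / 16) / k := by ring
    linarith
  · linarith

/-- The net points lie on the circle of radius `m` about `z₀`. -/
private theorem rootedTight_dist_net (z₀ : ℂ) {m : ℝ} (hm : 0 ≤ m) (t : ℝ) :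
    dist (z₀ + (m : ℂ) * Complex.exp ((t : ℂ) * Complex.I)) z₀ = m := by
  rw [dist_eq_norm, add_sub_cancel_left, norm_mul, Complex.norm_real, Complex.norm_exp_ofReal_mul_I,
    mul_one, Real.norm_eq_abs, abs_of_nonneg hm]

/-- **Union bound over the net** for the traversal mass: the `k`-traversal mass of `D(z₀; N/A, N/2)` is at
most the sum over the `k` net points of the four-traversal masses of the small shells about them. -/
private theorem rootedTight_travMass_le_sum_net (H : SimpleGraph HexVertex) (Λ : Finset HexVertex)
    (a z : Sym2 HexVertex) {z₀ : ℂ} {N A : ℝ} {k : ℕ} (hN : 0 < N) (hA : 4 ≤ A) (hk : 2 ≤ k) :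
    travMass H Λ a z k z₀ (N / A) (N / 2) ≤ ∑ j ∈ Finset.range k, travMass H Λ a z 4
      (z₀ + ((7 * N / 16 : ℝ) : ℂ) *
        Complex.exp (((-Real.pi + 2 * Real.pi * j / k : ℝ) : ℂ) * Complex.I))
      (6 * Real.pi * (7 * N / 16) / k) (N / 16 - 2 * Real.pi * (7 * N / 16) / k) := by
  unfold travMass
  exact rootedTight_sum_ite_le (P := fun γ => IsHArc H γ) _
    (fun γ => pow_nonneg hexCriticalFugacity_pos_lt_one.1.le _)
    (fun γ hγ => rootedTight_cover hN hA hk hγ)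

/-- `travMass` is monotone under shrinking the shell (larger inner radius, smaller outer radius): the
traversal event only grows (`HasTraversals.mono'`), the weights are nonnegative. -/
private theorem rootedTight_travMass_mono (H : SimpleGraph HexVertex) (Λ : Finset HexVertex)
    (a z : Sym2 HexVertex) (k : ℕ) (x : ℂ) {r r' R R' : ℝ} (hr : r ≤ r') (hR : R' ≤ R) :
    travMass H Λ a z k x r R ≤ travMass H Λ a z k x r' R' := by
  unfold travMass
  refine Finset.sum_le_sum fun γ _ => ?_
  by_cases h : IsHArc H γ ∧ (arcCurve γ).HasTraversals k x r R
  · rw [if_pos h, if_pos ⟨h.1, h.2.mono' hr hR⟩]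
  · rw [if_neg h]
    split_ifs
    · exact pow_nonneg hexCriticalFugacity_pos_lt_one.1.le _
    · exact le_rfl

/-- The arc mass is nonnegative. -/
private theorem rootedTight_arcMass_nonneg (H : SimpleGraph HexVertex) (Λ : Finset HexVertex)
    (a z : Sym2 HexVertex) : 0 ≤ arcMass H Λ a z :=
  Finset.sum_nonneg fun γ _ => by
    split_ifs
    · exact pow_nonneg hexCriticalFugacity_pos_lt_one.1.le _
    · exact le_rfl

/-- **One net point.** In a configuration `(H, Λ)` virgin at `(z₀, N)`, `N ≥ 256`, with a rim door `{u, c}`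
(`u ∉ Λ`, `|c(u) - z₀| > N`) and a deep root `p` (`|c(p) - z₀| ≤ N/A ≤ N/4`, `q ∼ p`), for a centre `y` on the
circle `|y - z₀| = 7N/16` and a thin shell `D(y; ρ, N/16 - d)`: the punctured configuration `(H, Λ ∖ {p})` is
virgin at `(y, N/16 + 2)`, both `u` and `p` are outside that circle, and the pinch bound at scale `N/16 + 2`
(inner radius `ρ + 2 ≤ (N/16+2)/4`) bounds every virgin sub-configuration; `TravLocalization` then bounds the
four-traversal mass of the rooted class `{u, c} → {p, q}` by `K ((ρ+2)/(N/16+2))^{1+s}` times its arc mass. -/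
private theorem rootedTight_netPoint (hTL : TravLocalization) {s K Na : ℝ} (hK : 0 ≤ K)
    (hPb : ∀ (H : SimpleGraph HexVertex) (Λ : Finset HexVertex) (z₀ : ℂ) (η N : ℝ)
      (w w' : Sym2 HexVertex), Na ≤ N → 1 ≤ η → η ≤ N / 4 →
      IsVirgin H Λ z₀ N → Straddles Λ z₀ N w → Straddles Λ z₀ N w' →
      travMass H Λ w w' 4 z₀ η (N / 2) ≤ K * (η / N) ^ (1 + s) * arcMass H Λ w w')
    {H : SimpleGraph HexVertex} {Λ : Finset HexVertex} {z₀ y : ℂ} {N A ρ d : ℝ} {u c p q : HexVertex}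
    (hV : IsVirgin H Λ z₀ N) (hA : 4 ≤ A) (hNa : 16 * Na ≤ N) (hN : 256 ≤ N)
    (hy : dist y z₀ = 7 * N / 16) (hρ : 0 ≤ ρ) (hd : 0 ≤ d) (hρd : ρ + d + 4 < N / 16)
    (hd3 : d + 3 ≤ N / 32) (hρ2 : ρ + 3 / 2 ≤ N / 64)
    (hu : u ∉ Λ) (huc : hexGraph.Adj u c) (huN : N < dist (hexCenter u) z₀)
    (hp : dist (hexCenter p) z₀ ≤ N / A) (hqp : hexGraph.Adj q p) :
    travMass H (Λ.erase p) s(u, c) s(p, q) 4 y ρ (N / 16 - d) ≤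
      K * ((ρ + 2) / (N / 16 + 2)) ^ (1 + s) * arcMass H (Λ.erase p) s(u, c) s(p, q) := by
  have hN0 : 0 < N := by linarith
  have hpN : dist (hexCenter p) z₀ ≤ N / 4 :=
    hp.trans (div_le_div_of_nonneg_left hN0.le (by norm_num) hA)
  have hu' : u ∉ Λ.erase p := fun h => hu (Finset.mem_of_mem_erase h)
  have hp' : p ∉ Λ.erase p := Finset.notMem_erase p Λ
  have hθ : 0 ≤ K * ((ρ + 2) / (N / 16 + 2)) ^ (1 + s) :=
    mul_nonneg hK (Real.rpow_nonneg (by positivity) _)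
  -- the door vertex and the root are outside the `r₁`-circle about `y`
  have hyu : N / 16 + 2 < dist (hexCenter u) y := by
    have := dist_triangle (hexCenter u) y z₀
    rw [hy] at this
    linarith
  have hyp : N / 16 + 2 < dist (hexCenter p) y := by
    have := dist_triangle y (hexCenter p) z₀
    rw [hy, dist_comm y (hexCenter p)] at this
    linarith
  -- the punctured configuration is virgin about `y` at radius `r₁`
  have hVy : IsVirgin H (Λ.erase p) y (N / 16 + 2) := by
    refine ⟨fun v hv => ?_, fun v v' hv hv' hvv' => ?_⟩
    · have h1 := dist_triangle (hexCenter v) y z₀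
      rw [hy] at h1
      refine Finset.mem_erase.2 ⟨fun hvp => ?_, hV.mem v (by linarith)⟩
      rw [hvp] at hv
      linarith
    · have h1 := dist_triangle (hexCenter v) y z₀
      have h2 := dist_triangle (hexCenter v') y z₀
      rw [hy] at h1 h2
      exact hV.adj v v' (by linarith) (by linarith) hvv'
  -- every virgin sub-configuration about `y` obeys the pinch bound at scale `r₁`
  have hsub : ∀ (Λ' : Finset HexVertex) (m m' : Sym2 HexVertex), Λ' ⊆ Λ.erase p →
      IsVirgin H Λ' y (N / 16 + 2) → Straddles Λ' y (N / 16 + 2) m → Straddles Λ' y (N / 16 + 2) m' →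
      travMass H Λ' m m' 4 y (ρ + 2) (N / 16 - d - 2) ≤
        K * ((ρ + 2) / (N / 16 + 2)) ^ (1 + s) * arcMass H Λ' m m' := by
    intro Λ' m m' _ hV' hm hm'
    refine le_trans (rootedTight_travMass_mono H Λ' m m' 4 y le_rfl ?_)
      (hPb H Λ' y (ρ + 2) (N / 16 + 2) m m' (by linarith) (by linarith) (by linarith) hV' hm hm')
    linarith
  exact hTL H (Λ.erase p) y (N / 16 + 2) ρ (N / 16 - d) (K * ((ρ + 2) / (N / 16 + 2)) ^ (1 + s)) 4
    u c p q (by norm_num) hθ hρ (by linarith) (by linarith) hu' hp' huc hqp.symm hyu hyp hVy hsub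

/-! ## The registered stub -/

/-- **stub E — ROOTED TIGHTNESS FROM THE PINCH BOUND** (`= TravLocalization → ArcPinchBound →
RootedTraversalTight` of the skeleton r5 of the line `reversal-virgin-disc`): at each aspect ratio `A ≥ 4` and
tolerance `η > 0` there is a threshold `k₀` such that, uniformly over virgin configurations at radius `N ≥ N₀`,
rim doors `w` and lattice root steps `q ∼ p` into a root `p` with `dist(c(p), z₀) ≤ N/A`, the `H`-arcs of
`Λ ∖ {p}` from `w` to `{q, p}` whose polyline traverses `D(z₀; N/A, N/2)` by `k₀` separate segments carry at most
`η` of the arc mass. Constants: `k₀ := ⌈(K 200^{1+s}/η)^{1/s}⌉₊ + 2000`, `N₀ := max (16 N₀') (max 256 k₀)` for the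
pinch data `(s, K, N₀')`. -/
theorem stub_rootedTightOfPinch :
    TravLocalization → ArcPinchBound →
    ∀ A : ℝ, 4 ≤ A → ∀ η : ℝ, 0 < η → ∃ (k₀ : ℕ) (N₀ : ℝ), 0 < N₀ ∧
      ∀ (H : SimpleGraph HexVertex) (Λ : Finset HexVertex) (z₀ : ℂ) (N : ℝ)
        (w : Sym2 HexVertex) (p q : HexVertex), N₀ ≤ N →
        IsVirgin H Λ z₀ N → Straddles Λ z₀ N w → dist (hexCenter p) z₀ ≤ N / A →
        hexGraph.Adj q p → H.Adj q p →
        travMass H (Λ.erase p) w s(q, p) k₀ z₀ (N / A) (N / 2) ≤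
          η * arcMass H (Λ.erase p) w s(q, p) := by
  intro hTL hP A hA η hη
  obtain ⟨s, K, Na, hs, hK, hNa, hPb⟩ := hP
  -- the threshold `k₀`
  obtain ⟨B, hB⟩ : ∃ B : ℝ, B = K * 200 ^ (1 + s) / η := ⟨_, rfl⟩
  have hB0 : 0 ≤ B := by rw [hB]; positivity
  obtain ⟨k₀, hk₀⟩ : ∃ k₀ : ℕ, k₀ = ⌈B ^ (1 / s)⌉₊ + 2000 := ⟨_, rfl⟩
  have hk2 : 2 ≤ k₀ := by rw [hk₀]; omega
  have hk2000 : (2000 : ℝ) ≤ k₀ := by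
    rw [hk₀]; push_cast; linarith [(Nat.cast_nonneg ⌈B ^ (1 / s)⌉₊ : (0 : ℝ) ≤ _)]
  have hkM : B ^ (1 / s) ≤ k₀ := by
    rw [hk₀]; push_cast; linarith [Nat.le_ceil (B ^ (1 / s))]
  have hkpos : (0 : ℝ) < k₀ := by linarith
  have hk0 : (k₀ : ℝ) ≠ 0 := hkpos.ne'
  -- `k₀ · K (200/k₀)^{1+s} ≤ η`
  have hkey : (k₀ : ℝ) * (K * (200 / (k₀ : ℝ)) ^ (1 + s)) ≤ η := by
    have hS : 0 < (k₀ : ℝ) ^ s := Real.rpow_pos_of_pos hkpos s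
    have hS0 : (k₀ : ℝ) ^ s ≠ 0 := hS.ne'
    have h1 : B ≤ (k₀ : ℝ) ^ s := by
      have := Real.rpow_le_rpow (Real.rpow_nonneg hB0 _) hkM hs.le
      rwa [← Real.rpow_mul hB0, one_div_mul_cancel hs.ne', Real.rpow_one] at this
    rw [hB, div_le_iff₀ hη] at h1
    rw [Real.div_rpow (by norm_num) hkpos.le, Real.rpow_add hkpos, Real.rpow_one,
      show (k₀ : ℝ) * (K * (200 ^ (1 + s) / (k₀ * k₀ ^ s))) = K * 200 ^ (1 + s) / k₀ ^ s by
        field_simp,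
      div_le_iff₀ hS]
    linarith
  refine ⟨k₀, max (16 * Na) (max 256 (k₀ : ℝ)), lt_max_of_lt_left (by linarith), ?_⟩
  intro H Λ z₀ N w p q hN hV hw hp hqp _
  have hNa16 : 16 * Na ≤ N := (le_max_left _ _).trans hN
  have hN256 : (256 : ℝ) ≤ N := (le_max_left _ _).trans ((le_max_right _ _).trans hN)
  have hNk : (k₀ : ℝ) ≤ N := (le_max_right _ _).trans ((le_max_right _ _).trans hN)
  have hNpos : 0 < N := by linarith
  obtain ⟨u, c, rfl, huc, hu, -, -, huN⟩ := hw
  rw [show s(q, p) = s(p, q) from Sym2.eq_swap]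
  -- the small-shell radii about the net points
  set ρ : ℝ := 6 * Real.pi * (7 * N / 16) / k₀ with hρ
  set d : ℝ := 2 * Real.pi * (7 * N / 16) / k₀ with hd
  have hρ0 : 0 ≤ ρ := by positivity
  have hd0 : 0 ≤ d := by positivity
  have hπN : Real.pi * N ≤ 4 * N := mul_le_mul_of_nonneg_right Real.pi_le_four hNpos.le
  have hρk : ρ * k₀ = 6 * Real.pi * (7 * N / 16) := by rw [hρ]; field_simp
  have hdk : d * k₀ = 2 * Real.pi * (7 * N / 16) := by rw [hd]; field_simp
  have hρN : 2000 * ρ ≤ 11 * N := by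
    have h1 : 2000 * ρ ≤ (k₀ : ℝ) * ρ := mul_le_mul_of_nonneg_right hk2000 hρ0
    linarith
  have hdN : 2000 * d ≤ 4 * N := by
    have h1 : 2000 * d ≤ (k₀ : ℝ) * d := mul_le_mul_of_nonneg_right hk2000 hd0
    linarith
  have hratio : (ρ + 2) / (N / 16 + 2) ≤ 200 / k₀ := by
    rw [div_le_div_iff₀ (by positivity) hkpos]
    nlinarith
  have hθ : K * ((ρ + 2) / (N / 16 + 2)) ^ (1 + s) ≤ K * (200 / (k₀ : ℝ)) ^ (1 + s) :=
    mul_le_mul_of_nonneg_left (Real.rpow_le_rpow (by positivity) hratio (by linarith)) hK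
  have harc := rootedTight_arcMass_nonneg H (Λ.erase p) s(u, c) s(p, q)
  calc travMass H (Λ.erase p) s(u, c) s(p, q) k₀ z₀ (N / A) (N / 2)
      ≤ _ := rootedTight_travMass_le_sum_net H (Λ.erase p) s(u, c) s(p, q) hNpos hA hk2
    _ ≤ ∑ j ∈ Finset.range k₀,
          K * ((ρ + 2) / (N / 16 + 2)) ^ (1 + s) * arcMass H (Λ.erase p) s(u, c) s(p, q) :=
        Finset.sum_le_sum fun j _ => rootedTight_netPoint hTL hK hPb hV hA hNa16 hN256
          (rootedTight_dist_net z₀ (by positivity) _) hρ0 hd0 (by linarith) (by linarith) (by linarith)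
          hu huc huN hp hqp
    _ = k₀ * (K * ((ρ + 2) / (N / 16 + 2)) ^ (1 + s) * arcMass H (Λ.erase p) s(u, c) s(p, q)) := by
        rw [Finset.sum_const, Finset.card_range, nsmul_eq_mul]
    _ ≤ k₀ * (K * (200 / (k₀ : ℝ)) ^ (1 + s) * arcMass H (Λ.erase p) s(u, c) s(p, q)) :=
        mul_le_mul_of_nonneg_left (mul_le_mul_of_nonneg_right hθ harc) hkpos.le
    _ = k₀ * (K * (200 / (k₀ : ℝ)) ^ (1 + s)) * arcMass H (Λ.erase p) s(u, c) s(p, q) := by ring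
    _ ≤ η * arcMass H (Λ.erase p) s(u, c) s(p, q) := mul_le_mul_of_nonneg_right hkey harc

end Summit.CriticalPhenomena.SAWScalingLimit.Theorems.HexTight.Reversal

end
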